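import Literature.Barriers.HodgeConjecture.DecompositionOfTheDiagonalHodgeProofs
import Literature.Barriers.HodgeConjecture.DecompositionOfTheDiagonalGenericPointProofs
import Literature.AlgebraicGeometry.HodgeTheory.CorrespondenceActionOfGysin
import Literature.AlgebraicGeometry.HodgeTheory.SupportedClassesHodgeConiveauHolds
import Literature.AlgebraicGeometry.HodgeTheory.ComplexOrientationDegreeFormulaHolds
import Literature.AlgebraicGeometry.Resolution.ProjectiveResolutionProofs
import HarnessLib

/-!
# Bloch–Srinivas / Voisin II Thm. 10.17: `(l,0)`-classes vanish when `CH₀` is small — PROVED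

Layer `Literature/Barriers/HodgeConjecture`. DISCHARGE of the named fact
`BlochSrinivas1983_hodgeTypeL0_vanish_of_chowZeroSupported` (`DecompositionOfTheDiagonal.lean`: on a
smooth projective complex variety whose `CH₀` is supported on a closed algebraic subset of dimension
`≤ d`, every class of Hodge type `(l,0)` with `l > d` vanishes — Bloch–Srinivas 1983, generalising
Mumford and Roitman; Voisin II Thm. 10.17). The tree's assembly `…_of_facts` took (F0) the
decomposition of the diagonal — a theorem (`BlochSrinivas1983_decompositionOfTheDiagonal_holds`), (F1) an
action of correspondences on `H*(X(ℂ); ℂ)` for every smooth projective `X` — supplied by any Gysin /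
cycle-class formalism (`GysinFormalism.correspondenceAction`, with Hironaka and Hodge models discharged)
and one EXISTS unconditionally since `ComplexOrientationDegreeFormulaHolds`
(`exists_gysinFormalism_isGysinHodgeCompatible_complexOrientation_holds`), and (F2) Grothendieck's "classes
supported in codimension `≥ 1` have Hodge coniveau `≥ 1`" — a theorem
(`Grothendieck1969_supportedClasses_le_hodgeConiveau_holds`).

## References

* [BlochSrinivas1983] S. Bloch, V. Srinivas, Remarks on correspondences and algebraic cycles, Amer. J.
  Math. 105 (1983), Thm. 1 (1).
* [VoisinHodgeII2003] C. Voisin, Hodge Theory and Complex Algebraic Geometry II, Thm. 10.17 and its proof.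
* [GrothendieckTopology1969] A. Grothendieck, Hodge's general conjecture is false for trivial reasons,
  Topology 8 (1969), p. 299 (∗).
-/

noncomputable section

namespace Literature.Barriers.HodgeConjecture

open Literature.AlgebraicGeometry Literature.AlgebraicGeometry.HodgeTheory

/-- **Bloch–Srinivas 1983 / Voisin II Thm. 10.17, PROVED**: on a smooth projective complex variety with
`CH₀` supported in dimension `≤ d`, classes of Hodge type `(l,0)`, `l > d`, vanish (discharge of
`BlochSrinivas1983_hodgeTypeL0_vanish_of_chowZeroSupported` through `…_of_facts`, the decomposition of the
diagonal, the correspondence action of the unconditional complex-orientation Gysin formalism, and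
Grothendieck's coniveau remark — all theorems of the tree). [cite: BlochSrinivas1983, Thm. 1 (1)]
[cite: VoisinHodgeII2003, Thm. 10.17 and its proof] -/
theorem BlochSrinivas1983_hodgeTypeL0_vanish_of_chowZeroSupported_holds :
    BlochSrinivas1983_hodgeTypeL0_vanish_of_chowZeroSupported := by
  obtain ⟨G, -⟩ := exists_gysinFormalism_isGysinHodgeCompatible_complexOrientation_holds
  exact BlochSrinivas1983_hodgeTypeL0_vanish_of_chowZeroSupported_of_facts
    BlochSrinivas1983_decompositionOfTheDiagonal_holds
    (nonempty_correspondenceAction_of_gysinFormalism G Resolution.Hironaka1964_projective_holds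
      fun _ _ ↦ nonempty_hodgeModel_holds)
    Grothendieck1969_supportedClasses_le_hodgeConiveau_holds

end Literature.Barriers.HodgeConjecture

end
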